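import Literature.NumberTheory.ConnesMoscovici2022.UVProlateInhomogeneousToolkit
import Literature.NumberTheory.ConnesMoscovici2022.UVProlateMaxDomainBoundaryBC

/-!
# RH-FREE. Connes–Moscovici 2022, Thm 1.6 (i), symmetric half: `⟪W_max ξ₁, ξ₂⟫ = ⟪ξ₁, W_max ξ₂⟫` on
# `𝓛_β` REDUCED to the vanishing of the boundary form at `±∞`

LINE 1 FRAMING: RH-FREE corpus literature (cell rh-crit, C1 Connes–Consani/Moscovici corpus, row O2
`UVProlateSpectrum`; Sturm–Liouville bookkeeping for `W_λ = −∂ₓ(λ² − x²)∂ₓ + (2πλx)²`).  bears_on: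
W-C/W-P only (sequel material, no leaf role).  WHAT THIS IS NOT: nothing here bears on the truth of
RH; no statement about zeta zeros; theorems only (0 defs, 0 named facts); `CM22_thm_1_6` stays a
named fact (this file proves NO conjunct of it outright — it isolates the `±∞` input).

## What is proved (stage (D) of the cell's cut for Thm 1.6, seat cc-t6; (D-∞) = the `+∞` asymptotics
## of general `dom W_max` elements is seat cc-t14's module (B))

For `ξ₁, ξ₂ ∈ 𝓛_β = prolateSASet λ` with regular representatives `g₁, g₂` (companion modules:
`exists_regular_repr_of_mem_prolateSASet`) and `ηᵢ = W_max ξᵢ`, write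
`F := conj(η₁)·g₂ − conj(g₁)·η₂` (an `L¹(ℝ)` function whose integral is `⟪η₁, ξ₂⟫ − ⟪ξ₁, η₂⟫`) and
`BF(s) := conj(g₁(s))·(p g₂′)(s) − conj((p g₁′)(s))·g₂(s)` (the Lagrange boundary form `[ξ₁, ξ₂]`
of (1.5)–(1.6), conjugate-linear in the first slot).

* `intervalIntegral_lagrange_pair` — on `[x, y]` inside a component of `ℝ ∖ {±λ}`:
  `∫_x^y F = BF(y) − BF(x)` (t14's bilinear `intervalIntegral_lagrange_of_primitive` applied to
  `(conj g₁, g₂)`; `p, q` real);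
* `intervalIntegral_middle_eq_zero` — `∫_{−λ}^{λ} F = 0` (the four `±λ` boundary terms vanish by (1.19),
  `tendsto_boundaryForm_zero_four_sides`, and t14's `intervalIntegral_eq_zero_of_boundary_tendsto_zero`);
* `intervalIntegral_right_eq_boundaryForm` / `…left…` — `∫_λ^R F = BF(R)` and `∫_{−R}^{−λ} F = −BF(−R)`
  for `R > λ`; hence `intervalIntegral_symm_eq_boundaryForm`: `∫_{−R}^{R} F = BF(R) − BF(−R)`;
* `integral_F_eq_inner_sub` — `∫_ℝ F = ⟪η₁, ξ₂⟫ − ⟪ξ₁, η₂⟫`;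
* **`inner_prolateMax_symm_of_tendsto_boundaryForm`** — if `BF(R) − BF(−R) → 0` as `R → +∞`, then
  `⟪W_max ξ₁, ξ₂⟫ = ⟪ξ₁, W_max ξ₂⟫`.  The hypothesis is exactly what the boundary conditions
  (1.20)/(1.21) at `±∞` deliver through the asymptotics of general `dom W_max` elements
  (`x g(x) ∼ A sin ωx + B cos ωx`; the parity split `[g₁,g₂](R) − [g₁,g₂](−R) =
  2([g₁⁺,g₂⁺] + [g₁⁻,g₂⁻])(R) → 0`), which is NOT proved here.

Printed source: [ConnesMoscovici2022] = arXiv:2112.05500v1, proof of Thm 2.6 (chunk p0006:L81–L114: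
«`W_sa` is symmetric, i.e. `Ω` vanishes on `𝓛_β × 𝓛_β` … the boundary terms vanish because of the
boundary conditions») with (1.4)–(1.6) (chunk p0005:L16–L31).  Cell rh-crit seat cc-t6 g4 (cut of
record cc/STATUS R135 (2)).
-/

noncomputable section

open Complex Set MeasureTheory Filter Topology intervalIntegral
open scoped Real Topology ContDiff InnerProductSpace ComplexConjugate

namespace Literature.NumberTheory.ConnesMoscovici2022

open Literature.NumberTheory.ConnesConsani2021 Literature.NumberTheory.ConnesConsani2024

section Pair

variable {lam : ℝ} {ξ₁ ξ₂ η₁ η₂ : L2R} {g₁ g₂ : ℝ → ℂ}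

/-- `star p = p` (`p = λ² − x²` is real). [folklore] -/
private theorem star_pCoeff (lam x : ℝ) : star (pCoeff lam x) = pCoeff lam x := by
  rw [pCoeff]; exact Complex.conj_ofReal _

/-- `star q = q` (`q = (2πλ)²x²` is real). [folklore] -/
private theorem star_qCoeff (lam x : ℝ) : star (qCoeff lam x) = qCoeff lam x := by
  rw [qCoeff]; exact Complex.conj_ofReal _

/-- `ℝ ∖ {±λ}` is open. [folklore] -/
private theorem isOpen_U (lam : ℝ) : IsOpen {x : ℝ | x ≠ lam ∧ x ≠ -lam} :=
  isOpen_ne.and isOpen_ne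

/-- An `L²(ℝ)` class is integrable on bounded intervals. [folklore] -/
private theorem intervalIntegrable_coe (η : L2R) (x y : ℝ) :
    IntervalIntegrable (fun t ↦ ((η : ℝ → ℂ)) t) volume x y :=
  (intervalIntegrable_iff').2
    ((((Lp.memLp η).locallyIntegrable (by norm_num)).integrableOn_isCompact isCompact_uIcc))


/-- Conjugation preserves interval integrability. [folklore] -/
private theorem intervalIntegrable_star {f : ℝ → ℂ} {x y : ℝ} (hf : IntervalIntegrable f volume x y) :
    IntervalIntegrable (fun t ↦ star (f t)) volume x y := by
  constructor
  · exact (Complex.conjCLE : ℂ →L[ℝ] ℂ).integrable_comp hf.1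
  · exact (Complex.conjCLE : ℂ →L[ℝ] ℂ).integrable_comp hf.2

/-- Conjugation commutes with the interval integral (`x ≤ y`). [folklore] -/
private theorem star_intervalIntegral {f : ℝ → ℂ} {x y : ℝ} (hxy : x ≤ y) :
    star (∫ t in x..y, f t) = ∫ t in x..y, star (f t) := by
  rw [intervalIntegral.integral_of_le hxy, intervalIntegral.integral_of_le hxy,
    ← starRingEnd_apply, ← integral_conj]
  rfl

/-- RH-FREE (PROVED). **Lagrange's identity for a pair of regular representatives** (sesquilinear):
on `[x, y]` inside a component of `ℝ ∖ {±λ}`, with `p gᵢ′` a primitive of `q gᵢ − ηᵢ` (the FTC shape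
of `exists_regular_repr`),
`∫_x^y (conj η₁ · g₂ − conj g₁ · η₂) = [conj g₁ · (p g₂′) − conj (p g₁′) · g₂]_x^y`.
[cite: ConnesMoscovici2022, §1 eqs. (1.4)–(1.6) (= arXiv (2.4)–(2.6), chunk p0005:L16–L31)] -/
theorem intervalIntegral_lagrange_pair
    (hg₁ : ContDiffOn ℝ 1 g₁ {x | x ≠ lam ∧ x ≠ -lam})
    (hftc₁ : ∀ x y, x ≤ y → Icc x y ⊆ {x | x ≠ lam ∧ x ≠ -lam} →
      pCoeff lam y * deriv g₁ y - pCoeff lam x * deriv g₁ x =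
        ∫ t in x..y, (qCoeff lam t * g₁ t - η₁ t))
    (hg₂ : ContDiffOn ℝ 1 g₂ {x | x ≠ lam ∧ x ≠ -lam})
    (hftc₂ : ∀ x y, x ≤ y → Icc x y ⊆ {x | x ≠ lam ∧ x ≠ -lam} →
      pCoeff lam y * deriv g₂ y - pCoeff lam x * deriv g₂ x =
        ∫ t in x..y, (qCoeff lam t * g₂ t - η₂ t))
    {x y : ℝ} (hxy : x ≤ y) (hI : Icc x y ⊆ {x | x ≠ lam ∧ x ≠ -lam}) :
    ∫ t in x..y, (star (η₁ t) * g₂ t - star (g₁ t) * η₂ t) =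
      (star (g₁ y) * (pCoeff lam y * deriv g₂ y) - star (pCoeff lam y * deriv g₁ y) * g₂ y) -
        (star (g₁ x) * (pCoeff lam x * deriv g₂ x) - star (pCoeff lam x * deriv g₁ x) * g₂ x) := by
  set U : Set ℝ := {x | x ≠ lam ∧ x ≠ -lam} with hU
  have hUo : IsOpen U := isOpen_U lam
  have huI : uIcc x y = Icc x y := uIcc_of_le hxy
  -- derivatives and their continuity on `[x, y]`
  have hd₁ : ∀ s ∈ Icc x y, HasDerivAt g₁ (deriv g₁ s) s := fun s hs ↦
    ((hg₁.differentiableOn one_ne_zero s (hI hs)).differentiableAt (hUo.mem_nhds (hI hs))).hasDerivAt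
  have hd₂ : ∀ s ∈ Icc x y, HasDerivAt g₂ (deriv g₂ s) s := fun s hs ↦
    ((hg₂.differentiableOn one_ne_zero s (hI hs)).differentiableAt (hUo.mem_nhds (hI hs))).hasDerivAt
  have hc₁ : ContinuousOn (deriv g₁) (Icc x y) :=
    (hg₁.continuousOn_deriv_of_isOpen hUo le_rfl).mono hI
  have hc₂ : ContinuousOn (deriv g₂) (Icc x y) :=
    (hg₂.continuousOn_deriv_of_isOpen hUo le_rfl).mono hI
  have hg₁c : ContinuousOn g₁ (Icc x y) := fun s hs ↦ (hd₁ s hs).continuousAt.continuousWithinAt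
  have hg₂c : ContinuousOn g₂ (Icc x y) := fun s hs ↦ (hd₂ s hs).continuousAt.continuousWithinAt
  have hqc : Continuous (qCoeff lam) := by unfold qCoeff; fun_prop
  -- the conjugated first triple
  have hd₁' : ∀ s ∈ Icc x y, HasDerivAt (fun t ↦ star (g₁ t)) (star (deriv g₁ s)) s :=
    fun s hs ↦ (hd₁ s hs).star
  have hc₁' : ContinuousOn (fun s ↦ star (deriv g₁ s)) (Icc x y) :=
    (continuous_star.comp_continuousOn hc₁)
  -- interval integrability of the two inhomogeneities
  have hf₂ : IntervalIntegrable (fun t ↦ qCoeff lam t * g₂ t - η₂ t) volume x y :=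
    (((hqc.continuousOn.mul hg₂c).mono huI.subset).intervalIntegrable).sub
      (intervalIntegrable_coe η₂ x y)
  have hf₁ : IntervalIntegrable (fun t ↦ qCoeff lam t * star (g₁ t) - star (η₁ t)) volume x y :=
    (((hqc.continuousOn.mul (continuous_star.comp_continuousOn hg₁c)).mono huI.subset
      ).intervalIntegrable).sub (intervalIntegrable_star (intervalIntegrable_coe η₁ x y))
  -- the FTC forms
  have hF₂ : ∀ s ∈ Icc x y, pCoeff lam s * deriv g₂ s =
      pCoeff lam x * deriv g₂ x + ∫ t in x..s, (qCoeff lam t * g₂ t - η₂ t) := by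
    intro s hs
    have h := hftc₂ x s hs.1 ((Icc_subset_Icc_right hs.2).trans hI)
    rw [← h]; ring
  have hF₁ : ∀ s ∈ Icc x y, pCoeff lam s * star (deriv g₁ s) =
      pCoeff lam x * star (deriv g₁ x) +
        ∫ t in x..s, (qCoeff lam t * star (g₁ t) - star (η₁ t)) := by
    intro s hs
    have h := hftc₁ x s hs.1 ((Icc_subset_Icc_right hs.2).trans hI)
    have h' := congrArg star h
    rw [star_sub, star_mul', star_mul', star_pCoeff, star_pCoeff,
      star_intervalIntegral hs.1] at h'
    have e : (fun t ↦ star (qCoeff lam t * g₁ t - η₁ t)) =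
        fun t ↦ qCoeff lam t * star (g₁ t) - star (η₁ t) := by
      funext t; rw [star_sub, star_mul', star_qCoeff]
    rw [e] at h'
    rw [← h']; ring
  have key := intervalIntegral_lagrange_of_primitive hxy (p := pCoeff lam)
    (g₁ := fun t ↦ star (g₁ t)) (g₁' := fun t ↦ star (deriv g₁ t))
    (u₁ := fun s ↦ pCoeff lam s * star (deriv g₁ s))
    (f₁ := fun t ↦ qCoeff lam t * star (g₁ t) - star (η₁ t))
    (g₂ := g₂) (g₂' := deriv g₂) (u₂ := fun s ↦ pCoeff lam s * deriv g₂ s)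
    (f₂ := fun t ↦ qCoeff lam t * g₂ t - η₂ t)
    hd₁' hc₁' (fun s _ ↦ rfl) hF₁ hf₁ hd₂ hc₂ (fun s _ ↦ rfl) hF₂ hf₂
  have e1 : (fun t ↦ star (g₁ t) * (qCoeff lam t * g₂ t - η₂ t) -
      (qCoeff lam t * star (g₁ t) - star (η₁ t)) * g₂ t) =
      fun t ↦ star (η₁ t) * g₂ t - star (g₁ t) * η₂ t := by
    funext t; ring
  rw [e1] at key
  rw [key, star_mul', star_mul', star_pCoeff, star_pCoeff]

end Pair

section Symmetry

variable {lam : ℝ} {ξ₁ ξ₂ η₁ η₂ : L2R} {g₁ g₂ : ℝ → ℂ}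

/-- `star ∘ f ∈ L²` for `f ∈ L²`. [folklore] -/
private theorem memLp_two_star {f : ℝ → ℂ} (hf : MemLp f 2 volume) :
    MemLp (fun t ↦ star (f t)) 2 volume := by
  have hm : AEStronglyMeasurable (fun t ↦ star (f t)) volume :=
    continuous_star.comp_aestronglyMeasurable hf.1
  rw [memLp_two_iff_integrable_sq_norm hm]
  simpa [norm_star] using (memLp_two_iff_integrable_sq_norm hf.1).1 hf

/-- The symmetry defect density `F = conj η₁ · g₂ − conj g₁ · η₂` is integrable on `ℝ`
(products of two `L²` functions). [folklore] -/
private theorem integrable_F (hae₁ : ((ξ₁ : ℝ → ℂ)) =ᵐ[volume] g₁)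
    (hae₂ : ((ξ₂ : ℝ → ℂ)) =ᵐ[volume] g₂) :
    Integrable (fun t ↦ star ((η₁ : ℝ → ℂ) t) * g₂ t - star (g₁ t) * (η₂ : ℝ → ℂ) t) := by
  have hg₁ : MemLp g₁ 2 volume := (Lp.memLp ξ₁).ae_eq hae₁
  have hg₂ : MemLp g₂ 2 volume := (Lp.memLp ξ₂).ae_eq hae₂
  have h1 : Integrable ((fun t ↦ star ((η₁ : ℝ → ℂ) t)) * g₂) :=
    (memLp_two_star (Lp.memLp η₁)).integrable_mul hg₂
  have h2 : Integrable ((fun t ↦ star (g₁ t)) * fun t ↦ ((η₂ : ℝ → ℂ)) t) :=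
    (memLp_two_star hg₁).integrable_mul (Lp.memLp η₂)
  exact h1.sub h2

/-- RH-FREE (PROVED). **The middle component contributes nothing**: for two elements of `𝓛_β` with
regular representatives satisfying (1.19) in the four one-sided forms and continuous up to `±λ`,
`∫_{−λ}^{λ} (conj η₁ · g₂ − conj g₁ · η₂) = 0` («the boundary terms vanish»).
[cite: ConnesMoscovici2022, proof of Thm 1.6 (= arXiv Thm 2.6, chunk p0006:L81–L114)] -/
theorem intervalIntegral_middle_eq_zero (hlam : 0 < lam)
    (hae₁ : ((ξ₁ : ℝ → ℂ)) =ᵐ[volume] g₁) (hg₁ : ContDiffOn ℝ 1 g₁ {x | x ≠ lam ∧ x ≠ -lam})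
    (hftc₁ : ∀ x y, x ≤ y → Icc x y ⊆ {x | x ≠ lam ∧ x ≠ -lam} →
      pCoeff lam y * deriv g₁ y - pCoeff lam x * deriv g₁ x =
        ∫ t in x..y, (qCoeff lam t * g₁ t - η₁ t))
    (hT₁ : ∀ a, a = lam ∨ a = -lam →
      Tendsto (fun x ↦ pCoeff lam x * deriv g₁ x) (𝓝[>] a) (𝓝 0) ∧
      Tendsto (fun x ↦ pCoeff lam x * deriv g₁ x) (𝓝[<] a) (𝓝 0))
    (hL₁ : ∀ a, a = lam ∨ a = -lam →
      (∃ c, Tendsto g₁ (𝓝[>] a) (𝓝 c)) ∧ (∃ c, Tendsto g₁ (𝓝[<] a) (𝓝 c)))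
    (hae₂ : ((ξ₂ : ℝ → ℂ)) =ᵐ[volume] g₂) (hg₂ : ContDiffOn ℝ 1 g₂ {x | x ≠ lam ∧ x ≠ -lam})
    (hftc₂ : ∀ x y, x ≤ y → Icc x y ⊆ {x | x ≠ lam ∧ x ≠ -lam} →
      pCoeff lam y * deriv g₂ y - pCoeff lam x * deriv g₂ x =
        ∫ t in x..y, (qCoeff lam t * g₂ t - η₂ t))
    (hT₂ : ∀ a, a = lam ∨ a = -lam →
      Tendsto (fun x ↦ pCoeff lam x * deriv g₂ x) (𝓝[>] a) (𝓝 0) ∧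
      Tendsto (fun x ↦ pCoeff lam x * deriv g₂ x) (𝓝[<] a) (𝓝 0))
    (hL₂ : ∀ a, a = lam ∨ a = -lam →
      (∃ c, Tendsto g₂ (𝓝[>] a) (𝓝 c)) ∧ (∃ c, Tendsto g₂ (𝓝[<] a) (𝓝 c))) :
    ∫ t in (-lam)..lam, (star (η₁ t) * g₂ t - star (g₁ t) * η₂ t) = 0 := by
  have hll : -lam < lam := by linarith
  have hsub : Ioo (-lam) lam ⊆ {x : ℝ | x ≠ lam ∧ x ≠ -lam} := fun x hx ↦ ⟨hx.2.ne, hx.1.ne'⟩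
  refine intervalIntegral_eq_zero_of_boundary_tendsto_zero hll
    ((integrable_F (η₁ := η₁) (η₂ := η₂) hae₁ hae₂).intervalIntegrable)
    (fun x hx y hy hxy ↦ intervalIntegral_lagrange_pair hg₁ hftc₁ hg₂ hftc₂ hxy
      fun t ht ↦ hsub ⟨lt_of_lt_of_le hx.1 ht.1, lt_of_le_of_lt ht.2 hy.2⟩) ?_ ?_
  · exact (tendsto_boundaryForm_zero_four_sides hT₁ hL₁ hT₂ hL₂ (Or.inr rfl)).1
  · exact (tendsto_boundaryForm_zero_four_sides hT₁ hL₁ hT₂ hL₂ (Or.inl rfl)).2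

/-- RH-FREE (PROVED). **The right component up to `R`**: for `R > λ`,
`∫_λ^R (conj η₁ · g₂ − conj g₁ · η₂) = BF(R)` (the boundary form dies at `λ⁺` by (1.19)).
[cite: ConnesMoscovici2022, proof of Thm 1.6 (= arXiv Thm 2.6, chunk p0006:L81–L114)] -/
theorem intervalIntegral_right_eq_boundaryForm (hlam : 0 < lam)
    (hae₁ : ((ξ₁ : ℝ → ℂ)) =ᵐ[volume] g₁) (hg₁ : ContDiffOn ℝ 1 g₁ {x | x ≠ lam ∧ x ≠ -lam})
    (hftc₁ : ∀ x y, x ≤ y → Icc x y ⊆ {x | x ≠ lam ∧ x ≠ -lam} →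
      pCoeff lam y * deriv g₁ y - pCoeff lam x * deriv g₁ x =
        ∫ t in x..y, (qCoeff lam t * g₁ t - η₁ t))
    (hT₁ : ∀ a, a = lam ∨ a = -lam →
      Tendsto (fun x ↦ pCoeff lam x * deriv g₁ x) (𝓝[>] a) (𝓝 0) ∧
      Tendsto (fun x ↦ pCoeff lam x * deriv g₁ x) (𝓝[<] a) (𝓝 0))
    (hL₁ : ∀ a, a = lam ∨ a = -lam →
      (∃ c, Tendsto g₁ (𝓝[>] a) (𝓝 c)) ∧ (∃ c, Tendsto g₁ (𝓝[<] a) (𝓝 c)))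
    (hae₂ : ((ξ₂ : ℝ → ℂ)) =ᵐ[volume] g₂) (hg₂ : ContDiffOn ℝ 1 g₂ {x | x ≠ lam ∧ x ≠ -lam})
    (hftc₂ : ∀ x y, x ≤ y → Icc x y ⊆ {x | x ≠ lam ∧ x ≠ -lam} →
      pCoeff lam y * deriv g₂ y - pCoeff lam x * deriv g₂ x =
        ∫ t in x..y, (qCoeff lam t * g₂ t - η₂ t))
    (hT₂ : ∀ a, a = lam ∨ a = -lam →
      Tendsto (fun x ↦ pCoeff lam x * deriv g₂ x) (𝓝[>] a) (𝓝 0) ∧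
      Tendsto (fun x ↦ pCoeff lam x * deriv g₂ x) (𝓝[<] a) (𝓝 0))
    (hL₂ : ∀ a, a = lam ∨ a = -lam →
      (∃ c, Tendsto g₂ (𝓝[>] a) (𝓝 c)) ∧ (∃ c, Tendsto g₂ (𝓝[<] a) (𝓝 c)))
    {R : ℝ} (hR : lam < R) :
    ∫ t in lam..R, (star (η₁ t) * g₂ t - star (g₁ t) * η₂ t) =
      star (g₁ R) * (pCoeff lam R * deriv g₂ R) - star (pCoeff lam R * deriv g₁ R) * g₂ R := by
  set F : ℝ → ℂ := fun t ↦ star ((η₁ : ℝ → ℂ) t) * g₂ t - star (g₁ t) * (η₂ : ℝ → ℂ) t with hF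
  set BF : ℝ → ℂ := fun s ↦ star (g₁ s) * (pCoeff lam s * deriv g₂ s) -
    star (pCoeff lam s * deriv g₁ s) * g₂ s with hBF
  have hFi : Integrable F := integrable_F (η₁ := η₁) (η₂ := η₂) hae₁ hae₂
  have hsub : Ioi lam ⊆ {x : ℝ | x ≠ lam ∧ x ≠ -lam} := fun x hx ↦ ⟨ne_of_gt hx, by
    have : lam < x := hx; linarith⟩
  -- on `[y, R]`, `y > λ`: `∫_y^R F = BF R − BF y`
  have hId : ∀ y ∈ Ioo lam R, ∫ t in y..R, F t = BF R - BF y := fun y hy ↦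
    intervalIntegral_lagrange_pair hg₁ hftc₁ hg₂ hftc₂ hy.2.le
      fun t ht ↦ hsub (lt_of_lt_of_le hy.1 ht.1)
  -- `y ↦ ∫_y^R F` is continuous at `λ` from the right
  have h1 : Tendsto (fun y ↦ ∫ t in y..R, F t) (𝓝[>] lam) (𝓝 (∫ t in lam..R, F t)) := by
    have hcont : Continuous fun y ↦ ∫ t in y..R, F t := by
      refine ((continuous_primitive (fun _ _ ↦ hFi.intervalIntegrable) R).neg).congr
        fun y ↦ ?_
      simp only [Pi.neg_apply, integral_symm y R, neg_neg]
    exact (hcont.tendsto lam).mono_left nhdsWithin_le_nhds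
  have h2 : Tendsto (fun y ↦ ∫ t in y..R, F t) (𝓝[>] lam) (𝓝 (BF R - 0)) := by
    refine (tendsto_const_nhds.sub
      (tendsto_boundaryForm_zero_four_sides hT₁ hL₁ hT₂ hL₂ (Or.inl rfl)).1).congr' ?_
    filter_upwards [Ioo_mem_nhdsGT hR] with y hy
    exact (hId y hy).symm
  rw [sub_zero] at h2
  exact tendsto_nhds_unique h1 h2

/-- RH-FREE (PROVED). **The left component down to `−R`**: for `R > λ`,
`∫_{−R}^{−λ} (conj η₁ · g₂ − conj g₁ · η₂) = −BF(−R)` (the boundary form dies at `(−λ)⁻`).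
[cite: ConnesMoscovici2022, proof of Thm 1.6 (= arXiv Thm 2.6, chunk p0006:L81–L114)] -/
theorem intervalIntegral_left_eq_boundaryForm (hlam : 0 < lam)
    (hae₁ : ((ξ₁ : ℝ → ℂ)) =ᵐ[volume] g₁) (hg₁ : ContDiffOn ℝ 1 g₁ {x | x ≠ lam ∧ x ≠ -lam})
    (hftc₁ : ∀ x y, x ≤ y → Icc x y ⊆ {x | x ≠ lam ∧ x ≠ -lam} →
      pCoeff lam y * deriv g₁ y - pCoeff lam x * deriv g₁ x =
        ∫ t in x..y, (qCoeff lam t * g₁ t - η₁ t))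
    (hT₁ : ∀ a, a = lam ∨ a = -lam →
      Tendsto (fun x ↦ pCoeff lam x * deriv g₁ x) (𝓝[>] a) (𝓝 0) ∧
      Tendsto (fun x ↦ pCoeff lam x * deriv g₁ x) (𝓝[<] a) (𝓝 0))
    (hL₁ : ∀ a, a = lam ∨ a = -lam →
      (∃ c, Tendsto g₁ (𝓝[>] a) (𝓝 c)) ∧ (∃ c, Tendsto g₁ (𝓝[<] a) (𝓝 c)))
    (hae₂ : ((ξ₂ : ℝ → ℂ)) =ᵐ[volume] g₂) (hg₂ : ContDiffOn ℝ 1 g₂ {x | x ≠ lam ∧ x ≠ -lam})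
    (hftc₂ : ∀ x y, x ≤ y → Icc x y ⊆ {x | x ≠ lam ∧ x ≠ -lam} →
      pCoeff lam y * deriv g₂ y - pCoeff lam x * deriv g₂ x =
        ∫ t in x..y, (qCoeff lam t * g₂ t - η₂ t))
    (hT₂ : ∀ a, a = lam ∨ a = -lam →
      Tendsto (fun x ↦ pCoeff lam x * deriv g₂ x) (𝓝[>] a) (𝓝 0) ∧
      Tendsto (fun x ↦ pCoeff lam x * deriv g₂ x) (𝓝[<] a) (𝓝 0))
    (hL₂ : ∀ a, a = lam ∨ a = -lam →
      (∃ c, Tendsto g₂ (𝓝[>] a) (𝓝 c)) ∧ (∃ c, Tendsto g₂ (𝓝[<] a) (𝓝 c)))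
    {R : ℝ} (hR : lam < R) :
    ∫ t in (-R)..(-lam), (star (η₁ t) * g₂ t - star (g₁ t) * η₂ t) =
      -(star (g₁ (-R)) * (pCoeff lam (-R) * deriv g₂ (-R)) -
        star (pCoeff lam (-R) * deriv g₁ (-R)) * g₂ (-R)) := by
  set F : ℝ → ℂ := fun t ↦ star ((η₁ : ℝ → ℂ) t) * g₂ t - star (g₁ t) * (η₂ : ℝ → ℂ) t with hF
  set BF : ℝ → ℂ := fun s ↦ star (g₁ s) * (pCoeff lam s * deriv g₂ s) -
    star (pCoeff lam s * deriv g₁ s) * g₂ s with hBF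
  have hFi : Integrable F := integrable_F (η₁ := η₁) (η₂ := η₂) hae₁ hae₂
  have hsub : Iio (-lam) ⊆ {x : ℝ | x ≠ lam ∧ x ≠ -lam} := fun x hx ↦ ⟨by
    have : x < -lam := hx; linarith, ne_of_lt hx⟩
  have hId : ∀ y ∈ Ioo (-R) (-lam), ∫ t in (-R)..y, F t = BF y - BF (-R) := fun y hy ↦
    intervalIntegral_lagrange_pair hg₁ hftc₁ hg₂ hftc₂ hy.1.le
      fun t ht ↦ hsub (lt_of_le_of_lt ht.2 hy.2)
  have h1 : Tendsto (fun y ↦ ∫ t in (-R)..y, F t) (𝓝[<] (-lam)) (𝓝 (∫ t in (-R)..(-lam), F t)) :=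
    ((continuous_primitive (fun _ _ ↦ hFi.intervalIntegrable) (-R)).tendsto (-lam)).mono_left
      nhdsWithin_le_nhds
  have h2 : Tendsto (fun y ↦ ∫ t in (-R)..y, F t) (𝓝[<] (-lam)) (𝓝 (0 - BF (-R))) := by
    refine ((tendsto_boundaryForm_zero_four_sides hT₁ hL₁ hT₂ hL₂ (Or.inr rfl)).2.sub
      tendsto_const_nhds).congr' ?_
    filter_upwards [Ioo_mem_nhdsLT (show -R < -lam by linarith)] with y hy
    exact (hId y hy).symm
  rw [zero_sub] at h2
  exact tendsto_nhds_unique h1 h2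

/-- RH-FREE (PROVED). **`∫_{−R}^{R} F = BF(R) − BF(−R)`** for `R > λ`: the three components glued
(middle one zero). [cite: ConnesMoscovici2022, proof of Thm 1.6 (= arXiv Thm 2.6, chunk p0006:L81–L114)] -/
theorem intervalIntegral_symm_eq_boundaryForm (hlam : 0 < lam)
    (hae₁ : ((ξ₁ : ℝ → ℂ)) =ᵐ[volume] g₁) (hg₁ : ContDiffOn ℝ 1 g₁ {x | x ≠ lam ∧ x ≠ -lam})
    (hftc₁ : ∀ x y, x ≤ y → Icc x y ⊆ {x | x ≠ lam ∧ x ≠ -lam} →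
      pCoeff lam y * deriv g₁ y - pCoeff lam x * deriv g₁ x =
        ∫ t in x..y, (qCoeff lam t * g₁ t - η₁ t))
    (hT₁ : ∀ a, a = lam ∨ a = -lam →
      Tendsto (fun x ↦ pCoeff lam x * deriv g₁ x) (𝓝[>] a) (𝓝 0) ∧
      Tendsto (fun x ↦ pCoeff lam x * deriv g₁ x) (𝓝[<] a) (𝓝 0))
    (hL₁ : ∀ a, a = lam ∨ a = -lam →
      (∃ c, Tendsto g₁ (𝓝[>] a) (𝓝 c)) ∧ (∃ c, Tendsto g₁ (𝓝[<] a) (𝓝 c)))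
    (hae₂ : ((ξ₂ : ℝ → ℂ)) =ᵐ[volume] g₂) (hg₂ : ContDiffOn ℝ 1 g₂ {x | x ≠ lam ∧ x ≠ -lam})
    (hftc₂ : ∀ x y, x ≤ y → Icc x y ⊆ {x | x ≠ lam ∧ x ≠ -lam} →
      pCoeff lam y * deriv g₂ y - pCoeff lam x * deriv g₂ x =
        ∫ t in x..y, (qCoeff lam t * g₂ t - η₂ t))
    (hT₂ : ∀ a, a = lam ∨ a = -lam →
      Tendsto (fun x ↦ pCoeff lam x * deriv g₂ x) (𝓝[>] a) (𝓝 0) ∧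
      Tendsto (fun x ↦ pCoeff lam x * deriv g₂ x) (𝓝[<] a) (𝓝 0))
    (hL₂ : ∀ a, a = lam ∨ a = -lam →
      (∃ c, Tendsto g₂ (𝓝[>] a) (𝓝 c)) ∧ (∃ c, Tendsto g₂ (𝓝[<] a) (𝓝 c)))
    {R : ℝ} (hR : lam < R) :
    ∫ t in (-R)..R, (star (η₁ t) * g₂ t - star (g₁ t) * η₂ t) =
      (star (g₁ R) * (pCoeff lam R * deriv g₂ R) - star (pCoeff lam R * deriv g₁ R) * g₂ R) -
        (star (g₁ (-R)) * (pCoeff lam (-R) * deriv g₂ (-R)) -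
          star (pCoeff lam (-R) * deriv g₁ (-R)) * g₂ (-R)) := by
  have hFi : Integrable (fun t ↦ star ((η₁ : ℝ → ℂ) t) * g₂ t - star (g₁ t) * (η₂ : ℝ → ℂ) t) :=
    integrable_F (η₁ := η₁) (η₂ := η₂) hae₁ hae₂
  rw [← integral_add_adjacent_intervals (hFi.intervalIntegrable (a := -R) (b := -lam))
      (hFi.intervalIntegrable (a := -lam) (b := R)),
    ← integral_add_adjacent_intervals (hFi.intervalIntegrable (a := -lam) (b := lam))
      (hFi.intervalIntegrable (a := lam) (b := R)),
    intervalIntegral_left_eq_boundaryForm hlam hae₁ hg₁ hftc₁ hT₁ hL₁ hae₂ hg₂ hftc₂ hT₂ hL₂ hR,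
    intervalIntegral_middle_eq_zero hlam hae₁ hg₁ hftc₁ hT₁ hL₁ hae₂ hg₂ hftc₂ hT₂ hL₂,
    intervalIntegral_right_eq_boundaryForm hlam hae₁ hg₁ hftc₁ hT₁ hL₁ hae₂ hg₂ hftc₂ hT₂ hL₂ hR]
  ring

/-- RH-FREE (PROVED). **`∫_ℝ F = ⟪η₁, ξ₂⟫ − ⟪ξ₁, η₂⟫`** (Mathlib's `L²` inner product, conjugate-linear
in the first slot). [cite: ConnesMoscovici2022, §1 eq. (1.4) (= arXiv (2.4), chunk p0005:L16–L21)] -/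
theorem integral_F_eq_inner_sub (hae₁ : ((ξ₁ : ℝ → ℂ)) =ᵐ[volume] g₁)
    (hae₂ : ((ξ₂ : ℝ → ℂ)) =ᵐ[volume] g₂) :
    ∫ t, (star (η₁ t) * g₂ t - star (g₁ t) * η₂ t) = ⟪η₁, ξ₂⟫_ℂ - ⟪ξ₁, η₂⟫_ℂ := by
  have hg₁ : MemLp g₁ 2 volume := (Lp.memLp ξ₁).ae_eq hae₁
  have hg₂ : MemLp g₂ 2 volume := (Lp.memLp ξ₂).ae_eq hae₂
  have h1 : Integrable ((fun t ↦ star ((η₁ : ℝ → ℂ) t)) * g₂) :=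
    (memLp_two_star (Lp.memLp η₁)).integrable_mul hg₂
  have h2 : Integrable ((fun t ↦ star (g₁ t)) * fun t ↦ ((η₂ : ℝ → ℂ)) t) :=
    (memLp_two_star hg₁).integrable_mul (Lp.memLp η₂)
  have e1 : ⟪η₁, ξ₂⟫_ℂ = ∫ t, star ((η₁ : ℝ → ℂ) t) * g₂ t := by
    rw [L2.inner_def]
    refine integral_congr_ae ?_
    filter_upwards [hae₂] with t ht
    rw [← ht]; simp [mul_comm]
  have e2 : ⟪ξ₁, η₂⟫_ℂ = ∫ t, star (g₁ t) * (η₂ : ℝ → ℂ) t := by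
    rw [L2.inner_def]
    refine integral_congr_ae ?_
    filter_upwards [hae₁] with t ht
    rw [← ht]; simp [mul_comm]
  rw [e1, e2]
  exact integral_sub h1 h2

/-- RH-FREE (PROVED). **Symmetry of `W_max` on `𝓛_β`, REDUCED to the `±∞` boundary limit.**  Let
`ξ₁, ξ₂ ∈ prolateSASet λ` with regular representatives `g₁, g₂` (FTC form of `(p gᵢ′)′ = q gᵢ − W_max ξᵢ`,
(1.19) in the four one-sided forms, continuity up to `±λ` — as delivered by
`exists_regular_repr_of_mem_prolateSASet`).  If the Lagrange boundary form satisfies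
`BF(R) − BF(−R) → 0` as `R → +∞` (this is what the boundary conditions (1.20)/(1.21) at `±∞` give
through the `+∞` asymptotics of `dom W_max` elements — NOT proved here), then
`⟪W_max ξ₁, ξ₂⟫ = ⟪ξ₁, W_max ξ₂⟫`.
[cite: ConnesMoscovici2022, Thm 1.6 (i) and its proof (= arXiv Thm 2.6, chunk p0006:L76–L114)] -/
theorem inner_prolateMax_symm_of_tendsto_boundaryForm (hlam : 0 < lam)
    (hξ₁ : ξ₁ ∈ (prolateMax lam).domain) (hξ₂ : ξ₂ ∈ (prolateMax lam).domain)
    (hae₁ : ((ξ₁ : ℝ → ℂ)) =ᵐ[volume] g₁) (hg₁ : ContDiffOn ℝ 1 g₁ {x | x ≠ lam ∧ x ≠ -lam})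
    (hftc₁ : ∀ x y, x ≤ y → Icc x y ⊆ {x | x ≠ lam ∧ x ≠ -lam} →
      pCoeff lam y * deriv g₁ y - pCoeff lam x * deriv g₁ x =
        ∫ t in x..y, (qCoeff lam t * g₁ t - (prolateMax lam ⟨ξ₁, hξ₁⟩ : L2R) t))
    (hT₁ : ∀ a, a = lam ∨ a = -lam →
      Tendsto (fun x ↦ pCoeff lam x * deriv g₁ x) (𝓝[>] a) (𝓝 0) ∧
      Tendsto (fun x ↦ pCoeff lam x * deriv g₁ x) (𝓝[<] a) (𝓝 0))
    (hL₁ : ∀ a, a = lam ∨ a = -lam →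
      (∃ c, Tendsto g₁ (𝓝[>] a) (𝓝 c)) ∧ (∃ c, Tendsto g₁ (𝓝[<] a) (𝓝 c)))
    (hae₂ : ((ξ₂ : ℝ → ℂ)) =ᵐ[volume] g₂) (hg₂ : ContDiffOn ℝ 1 g₂ {x | x ≠ lam ∧ x ≠ -lam})
    (hftc₂ : ∀ x y, x ≤ y → Icc x y ⊆ {x | x ≠ lam ∧ x ≠ -lam} →
      pCoeff lam y * deriv g₂ y - pCoeff lam x * deriv g₂ x =
        ∫ t in x..y, (qCoeff lam t * g₂ t - (prolateMax lam ⟨ξ₂, hξ₂⟩ : L2R) t))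
    (hT₂ : ∀ a, a = lam ∨ a = -lam →
      Tendsto (fun x ↦ pCoeff lam x * deriv g₂ x) (𝓝[>] a) (𝓝 0) ∧
      Tendsto (fun x ↦ pCoeff lam x * deriv g₂ x) (𝓝[<] a) (𝓝 0))
    (hL₂ : ∀ a, a = lam ∨ a = -lam →
      (∃ c, Tendsto g₂ (𝓝[>] a) (𝓝 c)) ∧ (∃ c, Tendsto g₂ (𝓝[<] a) (𝓝 c)))
    (hinf : Tendsto (fun R ↦
        (star (g₁ R) * (pCoeff lam R * deriv g₂ R) - star (pCoeff lam R * deriv g₁ R) * g₂ R) -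
          (star (g₁ (-R)) * (pCoeff lam (-R) * deriv g₂ (-R)) -
            star (pCoeff lam (-R) * deriv g₁ (-R)) * g₂ (-R))) atTop (𝓝 0)) :
    ⟪(prolateMax lam ⟨ξ₁, hξ₁⟩ : L2R), ξ₂⟫_ℂ = ⟪ξ₁, (prolateMax lam ⟨ξ₂, hξ₂⟩ : L2R)⟫_ℂ := by
  set η₁' : L2R := (prolateMax lam ⟨ξ₁, hξ₁⟩ : L2R) with hη₁
  set η₂' : L2R := (prolateMax lam ⟨ξ₂, hξ₂⟩ : L2R) with hη₂
  have hFi : Integrable (fun t ↦ star ((η₁' : ℝ → ℂ) t) * g₂ t - star (g₁ t) * (η₂' : ℝ → ℂ) t) :=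
    integrable_F (η₁ := η₁') (η₂ := η₂') hae₁ hae₂
  -- `∫_{−R}^{R} F → ∫_ℝ F` and `= BF R − BF (−R) → 0`
  have hlim := intervalIntegral_tendsto_integral hFi tendsto_neg_atTop_atBot tendsto_id
  have hev : ∀ᶠ R : ℝ in atTop, ∫ t in (-R)..R,
      (star ((η₁' : ℝ → ℂ) t) * g₂ t - star (g₁ t) * (η₂' : ℝ → ℂ) t) =
      (star (g₁ R) * (pCoeff lam R * deriv g₂ R) - star (pCoeff lam R * deriv g₁ R) * g₂ R) -
        (star (g₁ (-R)) * (pCoeff lam (-R) * deriv g₂ (-R)) -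
          star (pCoeff lam (-R) * deriv g₁ (-R)) * g₂ (-R)) := by
    filter_upwards [eventually_gt_atTop lam] with R hR
    exact intervalIntegral_symm_eq_boundaryForm hlam hae₁ hg₁ hftc₁ hT₁ hL₁ hae₂ hg₂ hftc₂
      hT₂ hL₂ hR
  have h0 : ∫ t, (star ((η₁' : ℝ → ℂ) t) * g₂ t - star (g₁ t) * (η₂' : ℝ → ℂ) t) = 0 :=
    tendsto_nhds_unique hlim (hinf.congr' (hev.mono fun R hR ↦ hR.symm))
  have := integral_F_eq_inner_sub (η₁ := η₁') (η₂ := η₂') hae₁ hae₂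
  rw [h0] at this
  exact (sub_eq_zero.1 this.symm)

end Symmetry

end Literature.NumberTheory.ConnesMoscovici2022
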